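import Literature.AnabelianGeometry.SemiGraphs.TemperedThm37iiiIffNoAnchorFree
import Literature.AnabelianGeometry.SemiGraphs.TemperedExoticCompactLevelwiseEdgeLike
import Literature.AnabelianGeometry.SemiGraphs.TemperedGalFiniteSubgroupsBounded
import Literature.AnabelianGeometry.SemiGraphs.TemperedThm37OfCompactInVerticialAt
import HarnessLib

/-!
# [SemiAnbd] Thm 3.7 (iv) AT `𝒢` gives the existence sentence of Thm 3.7 (iii) AT `𝒢` (any edge groups);
# on topologically cyclic edge groups (iii)AT ⟺ (iv)AT, and the exotic compact subgroups are PROCYCLIC (proof-only)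

Mochizuki, *Semi-graphs of anabelioids*, Publ. RIMS **42** (2006), §3, Theorem 3.7 (iii) pp. 40–41, (iv) p. 41
[cite: MochizukiSemiAnbd2006, Thm 3.7(iii)(iv) pp.40-41]; Prop. 3.6 p. 38 (`π₁^temp(𝒢) = lim_n Gal(𝒢_{∞,n}/𝒢)`)
[cite: MochizukiSemiAnbd2006, Prop 3.6(i) p.38].

PROOF-ONLY file (abc-iut cell, layer L3, seat abc-iut-L3-t5 gen 13; items (c) and (a) of the successor list of
abc-iut-w6-d064's `TemperedThm37iiiIffNoAnchorFree.lean` / `TemperedExoticCompactLevelwiseEdgeLike.lean`; no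
definition, no named fact).  For OUR typed tempered fundamental group of a countable semi-graph of anabelioids:

* `TemperedPiChart.exists_isMaximalCompactSubgroup_ge` — **at EVERY chart of every `𝒢` satisfying the hypotheses
  of Prop. 3.6, every compact subgroup lies in a maximal compact subgroup** (abc-iut-L3-t6's binder-free Zorn
  lemma at the canonical chart, `exists_isMaximalCompactSubgroup_ge_temperedPiChart`, transported along
  `TemperedPiChart.exists_compatIso`).
* `exists_verticial_ge_of_maximalCompactIffVerticialAt` — **for ANY edge groups and any `𝔾`: Thm 3.7 (iv) AT `𝒢`
  implies the EXISTENCE sentence of Thm 3.7 (iii) AT `𝒢`** ("any compact subgroup of `π₁^temp(𝒢)` is contained in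
  at least one verticial subgroup": it lies in a maximal compact one, which is verticial) — the converse direction
  of abc-iut-w4-d075's `maximalCompactIffVerticialAt_of_compactInVerticialAt`; also the edge-like clause
  (`exists_edgeLike_ge_of_maximalCompactIffVerticialAt`).
* `compactInVerticialAt_iff_maximalCompactIffVerticialAt_of_topCyclic` — **with TOPOLOGICALLY CYCLIC edge groups
  (any `𝔾`) the cell's per-graph typings `CompactInVerticialAt 𝒢` and `MaximalCompactIffVerticialAt 𝒢` are
  EQUIVALENT** (abc-iut-f-172's reduction of (iii) to its existence sentence on the class); equivalently
  (`exists_isMaximalCompactSubgroup_ge_forall_inf_verticial_eq_bot_of_topCyclic`) a non-trivial ANCHOR-FREE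
  compact subgroup always lies below an anchor-free MAXIMAL compact subgroup — the two failure loci of
  `TemperedThm37iiiIffNoAnchorFree.lean` are inhabited together.  So there is NO graph of the class at which
  (iii) fails but (iv) holds.
* `GaloisLevelData.exists_topologicalClosure_zpowers_eq_of_forall_le_zpowers` — **a compact `K ≤ π₁^temp(𝒢) =
  lim_n Gal(𝒢_{∞,n}/𝒢)` all of whose level images `ρ_n(K)` lie in cyclic subgroups is TOPOLOGICALLY CYCLIC**,
  `K = ⟨k⟩‾` for one `k ∈ K` (the non-empty compact sets of elements of `K` generating `ρ_n(K)` decrease in `n`;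
  Cantor's intersection theorem; `mem_topologicalClosure_of_forall_proj`); hence
  (`exists_topologicalClosure_zpowers_eq_of_forall_not_le_verticial_of_topCyclic`, with abc-iut-w6-d064's
  `forall_level_exists_zpowers_of_forall_not_le_verticial_of_topCyclic`) **every compact subgroup of
  `π₁^temp(𝒢)` lying in NO verticial subgroup — every violator of Thm 3.7 (iii), every exotic maximal compact
  subgroup — is PROCYCLIC** when the edge groups are topologically cyclic, at every chart
  (`TemperedPiChart.exists_topologicalClosure_zpowers_eq_of_forall_not_le_verticial_of_topCyclic`); instances at
  `𝒢⋆(p)` and `𝒢_θ(p, n)` hypothesis-free.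

Honest framing: theorems about OUR typed `π₁^temp`; print's Thm 3.7 concerns the graphs of [SemiAnbd] §3 and is
not contradicted; nothing bears on [IUTchIII] Cor. 3.12; no side taken; typed ≠ proved.
-/

namespace Literature.AnabelianGeometry.SemiGraphs

namespace ProfiniteSemiGraph

open Topology

universe u

variable {𝒢 : ProfiniteSemiGraph.{u}}

/-! ### Maximal compact subgroups above a compact subgroup, at every chart -/

/-- Transport of maximal compact subgroups along a pair of mutually inverse continuous homomorphisms.
[cite: MochizukiSemiAnbd2006, Thm 3.7(iv) p.41] -/
private theorem isMaximalCompactSubgroup_map_of_inverse {A B : Type u} [Group A] [TopologicalSpace A]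
    [Group B] [TopologicalSpace B] (φ : A →ₜ* B) (ψ : B →ₜ* A) (hψφ : ∀ x, ψ (φ x) = x)
    (hφψ : ∀ y, φ (ψ y) = y) {K : Subgroup A} (hK : IsMaximalCompactSubgroup K) :
    IsMaximalCompactSubgroup (K.map φ.toMonoidHom) := by
  refine ⟨?_, fun K' hK' hle => ?_⟩
  · rw [Subgroup.coe_map]
    exact hK.1.image φ.continuous
  · have hpre : IsCompact ((K'.map ψ.toMonoidHom : Subgroup A) : Set A) := by
      rw [Subgroup.coe_map]
      exact hK'.image ψ.continuous
    have hle' : K ≤ K'.map ψ.toMonoidHom := fun k hk => ⟨φ k, hle ⟨k, hk, rfl⟩, hψφ k⟩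
    have heq := hK.2 _ hpre hle'
    refine le_antisymm (fun y hy => ?_) hle
    have hy' : ψ y ∈ K := by
      rw [← heq]
      exact ⟨y, hy, rfl⟩
    exact ⟨ψ y, hy', hφψ y⟩

/-- **Every compact subgroup of `π₁^temp(𝒢)` lies in a maximal compact subgroup — at EVERY chart** of every
`𝒢` satisfying the hypotheses of Prop. 3.6 (abc-iut-L3-t6's `exists_isMaximalCompactSubgroup_ge_temperedPiChart`
at the canonical chart, transported along the compatible isomorphism of charts `TemperedPiChart.exists_compatIso`).
[cite: MochizukiSemiAnbd2006, Thm 3.7(iv) p.41] -/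
theorem TemperedPiChart.exists_isMaximalCompactSubgroup_ge (h36 : 𝒢.Prop36Hypotheses)
    (c : TemperedPiChart 𝒢) (C : Subgroup c.G) (hC : IsCompact (C : Set c.G)) :
    ∃ K : Subgroup c.G, IsMaximalCompactSubgroup K ∧ C ≤ K := by
  obtain ⟨φ, ψ, hψφ, hφψ, -, -⟩ := TemperedPiChart.exists_compatIso (𝒢.temperedPiChart h36) c
  have hC' : IsCompact ((C.map ψ.toMonoidHom : Subgroup (𝒢.temperedPiChart h36).G) :
      Set (𝒢.temperedPiChart h36).G) := by
    rw [Subgroup.coe_map]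
    exact hC.image ψ.continuous
  obtain ⟨K, hK, hCK⟩ :=
    𝒢.exists_isMaximalCompactSubgroup_ge_temperedPiChart h36 (C.map ψ.toMonoidHom) hC'
  exact ⟨K.map φ.toMonoidHom, isMaximalCompactSubgroup_map_of_inverse φ ψ hψφ hφψ hK,
    fun g hg => ⟨ψ g, hCK ⟨g, hg, rfl⟩, hφψ g⟩⟩

/-! ### Thm 3.7 (iv) AT `𝒢` ⟹ the existence sentence of Thm 3.7 (iii) AT `𝒢` — any edge groups -/

/-- **Thm 3.7 (iv) AT `𝒢` implies the EXISTENCE sentence of Thm 3.7 (iii) AT `𝒢`, for ANY edge groups and any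
`𝔾`**: under the hypotheses of Thm 3.7, if the maximal compact subgroups of `π₁^temp(𝒢)` are exactly the verticial
ones (at every chart), then every compact subgroup lies in a verticial subgroup — namely in any maximal compact
subgroup above it (`TemperedPiChart.exists_isMaximalCompactSubgroup_ge`).
[cite: MochizukiSemiAnbd2006, Thm 3.7(iii) pp.40-41] -/
theorem exists_verticial_ge_of_maximalCompactIffVerticialAt (hIV : MaximalCompactIffVerticialAt 𝒢)
    (h37 : 𝒢.Thm37Hypotheses) (c : TemperedPiChart 𝒢) (C : Subgroup c.G) (hC : IsCompact (C : Set c.G)) :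
    ∃ (v : 𝒢.graph.Vertex) (H : Subgroup c.G), H ∈ verticialSubgroups c v ∧ C ≤ H := by
  obtain ⟨K, hK, hCK⟩ :=
    TemperedPiChart.exists_isMaximalCompactSubgroup_ge h37.toProp36Hypotheses c C hC
  obtain ⟨v, hKv⟩ := ((hIV h37 c).1 K).mp hK
  exact ⟨v, K, hKv, hCK⟩

/-- **The edge-like clause of Thm 3.7 (iii) AT `𝒢` from Thm 3.7 (iv) AT `𝒢`, any edge groups**: a non-trivial compact
subgroup lying in two DISTINCT verticial subgroups `H₁`, `H₂` lies in an edge-like subgroup of a closed edge —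
`H₁ ⊓ H₂` itself, a non-trivial intersection of two distinct maximal compact subgroups (second sentence of (iv)).
[cite: MochizukiSemiAnbd2006, Thm 3.7(iii) pp.40-41] -/
theorem exists_edgeLike_ge_of_maximalCompactIffVerticialAt (hIV : MaximalCompactIffVerticialAt 𝒢)
    (h37 : 𝒢.Thm37Hypotheses) (c : TemperedPiChart 𝒢) {C : Subgroup c.G} (hCne : C ≠ ⊥)
    {v₁ v₂ : 𝒢.graph.Vertex} {H₁ H₂ : Subgroup c.G} (hH₁ : H₁ ∈ verticialSubgroups c v₁)
    (hH₂ : H₂ ∈ verticialSubgroups c v₂) (hne : H₁ ≠ H₂) (hC₁ : C ≤ H₁) (hC₂ : C ≤ H₂) :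
    ∃ (e : 𝒢.graph.Edge) (L : Subgroup c.G), 𝒢.graph.IsClosedEdge e ∧ L ∈ edgeLikeSubgroups c e ∧ C ≤ L := by
  have hK₁ : IsMaximalCompactSubgroup H₁ := ((hIV h37 c).1 H₁).mpr ⟨v₁, hH₁⟩
  have hK₂ : IsMaximalCompactSubgroup H₂ := ((hIV h37 c).1 H₂).mpr ⟨v₂, hH₂⟩
  have hL : H₁ ⊓ H₂ ≠ ⊥ := fun h0 => hCne (le_bot_iff.mp (h0 ▸ le_inf hC₁ hC₂))
  obtain ⟨e, he, hLe⟩ := ((hIV h37 c).2 (H₁ ⊓ H₂) hL).mp ⟨H₁, H₂, hK₁, hK₂, hne, rfl⟩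
  exact ⟨e, H₁ ⊓ H₂, he, hLe, le_inf hC₁ hC₂⟩

/-- **Under Thm 3.7 (iv) AT `𝒢` (any edge groups), a compact subgroup lying in NO verticial subgroup does not
exist**: the exotic compact subgroups of abc-iut-w6-d064's `TemperedExoticCompactLevelwiseEdgeLike.lean` are
exactly what (iv) AT `𝒢` rules out. [cite: MochizukiSemiAnbd2006, Thm 3.7(iv) p.41] -/
theorem not_forall_not_le_verticial_of_maximalCompactIffVerticialAt (hIV : MaximalCompactIffVerticialAt 𝒢)
    (h37 : 𝒢.Thm37Hypotheses) (c : TemperedPiChart 𝒢) (K : Subgroup c.G) (hKc : IsCompact (K : Set c.G)) :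
    ¬ ∀ (v : 𝒢.graph.Vertex) (H : Subgroup c.G), H ∈ verticialSubgroups c v → ¬ K ≤ H := by
  intro hno
  obtain ⟨v, H, hH, hKH⟩ := exists_verticial_ge_of_maximalCompactIffVerticialAt hIV h37 c K hKc
  exact hno v H hH hKH

/-! ### Topologically cyclic edge groups: (iii) AT `𝒢` ⟺ (iv) AT `𝒢` -/

variable (𝒢)

/-- **Thm 3.7 (iv) AT `𝒢` ⟹ Thm 3.7 (iii) AT `𝒢` for TOPOLOGICALLY CYCLIC edge groups, any `𝔾`**: on the class,
`CompactInVerticialAt 𝒢` is its existence sentence (abc-iut-f-172's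
`compactInVerticialAt_iff_exists_verticial_of_topCyclic`), which (iv) AT `𝒢` supplies at any edge groups
(`exists_verticial_ge_of_maximalCompactIffVerticialAt`). [cite: MochizukiSemiAnbd2006, Thm 3.7(iii) pp.40-41] -/
theorem compactInVerticialAt_of_maximalCompactIffVerticialAt_of_topCyclic
    (hcyc : ∀ e : 𝒢.graph.Edge, ∃ t₀ : 𝒢.Ge e, (Subgroup.zpowers t₀).topologicalClosure = ⊤)
    (hIV : MaximalCompactIffVerticialAt 𝒢) : CompactInVerticialAt 𝒢 := by
  rw [𝒢.compactInVerticialAt_iff_exists_verticial_of_topCyclic hcyc]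
  exact fun h37 c C hC => exists_verticial_ge_of_maximalCompactIffVerticialAt hIV h37 c C hC

/-- **Thm 3.7 (iii) AT `𝒢` ⟺ Thm 3.7 (iv) AT `𝒢`, for every countable `𝒢` with TOPOLOGICALLY CYCLIC edge groups
(any `𝔾`)**: «⇒» is abc-iut-w4-d075's `maximalCompactIffVerticialAt_of_compactInVerticialAt` (any edge groups;
Thm 3.7 (i), (ii) discharged in the tree), «⇐» is `compactInVerticialAt_of_maximalCompactIffVerticialAt_of_topCyclic`.
So the cell's two per-graph typings hold or fail TOGETHER on the class: there is no graph with topologically cyclic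
edge groups at which (iii) fails but (iv) holds. [cite: MochizukiSemiAnbd2006, Thm 3.7(iii)(iv) pp.40-41] -/
theorem compactInVerticialAt_iff_maximalCompactIffVerticialAt_of_topCyclic
    (hcyc : ∀ e : 𝒢.graph.Edge, ∃ t₀ : 𝒢.Ge e, (Subgroup.zpowers t₀).topologicalClosure = ⊤) :
    CompactInVerticialAt 𝒢 ↔ MaximalCompactIffVerticialAt 𝒢 :=
  ⟨maximalCompactIffVerticialAt_of_compactInVerticialAt,
    𝒢.compactInVerticialAt_of_maximalCompactIffVerticialAt_of_topCyclic hcyc⟩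

variable {𝒢}

/-- **A non-trivial ANCHOR-FREE compact subgroup lies below an anchor-free MAXIMAL compact subgroup** (topologically
cyclic edge groups, any `𝔾`, every chart): any maximal compact `M ⊇ K` (`TemperedPiChart.exists_isMaximalCompactSubgroup_ge`)
meets every verticial subgroup trivially — if `M ⊓ H ≠ 1` for a verticial `H`, then `M` is anchored, hence inside a
verticial `H'` (abc-iut-w6-d064's `exists_verticial_ge_of_inf_verticial_ne_bot_of_topCyclic`), and so is `K ≠ 1`,
contradicting `K ⊓ H' = 1`.  (The converse disclaimed in the docstring of
`maximalCompactIffVerticialAt_of_compactInVerticialAt_of_topCyclic` therefore does hold on the class.)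
[cite: MochizukiSemiAnbd2006, Thm 3.7(iv) p.41] -/
theorem exists_isMaximalCompactSubgroup_ge_forall_inf_verticial_eq_bot_of_topCyclic (h37 : 𝒢.Thm37Hypotheses)
    (hcyc : ∀ e : 𝒢.graph.Edge, ∃ t₀ : 𝒢.Ge e, (Subgroup.zpowers t₀).topologicalClosure = ⊤)
    (c : TemperedPiChart 𝒢) (K : Subgroup c.G) (hKc : IsCompact (K : Set c.G)) (hK : K ≠ ⊥)
    (hfree : ∀ (v : 𝒢.graph.Vertex) (H : Subgroup c.G), H ∈ verticialSubgroups c v → K ⊓ H = ⊥) :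
    ∃ M : Subgroup c.G, IsMaximalCompactSubgroup M ∧ K ≤ M ∧
      ∀ (v : 𝒢.graph.Vertex) (H : Subgroup c.G), H ∈ verticialSubgroups c v → M ⊓ H = ⊥ := by
  obtain ⟨M, hM, hKM⟩ :=
    TemperedPiChart.exists_isMaximalCompactSubgroup_ge h37.toProp36Hypotheses c K hKc
  refine ⟨M, hM, hKM, fun v H hH => ?_⟩
  by_contra hne
  obtain ⟨v', H', hH', hMH'⟩ :=
    exists_verticial_ge_of_inf_verticial_ne_bot_of_topCyclic h37 hcyc c M hM.1 hH hne
  have h := hfree v' H' hH'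
  rw [inf_eq_left.mpr (hKM.trans hMH')] at h
  exact hK h

/-- **Such a maximal compact subgroup is NOT verticial** (it meets every verticial subgroup trivially and is
non-trivial), so Thm 3.7 (iv) fails AT `𝒢` as soon as one chart carries a non-trivial anchor-free compact subgroup
(topologically cyclic edge groups, any `𝔾`). [cite: MochizukiSemiAnbd2006, Thm 3.7(iv) p.41] -/
theorem not_maximalCompactIffVerticialAt_of_anchorFree_of_topCyclic (h37 : 𝒢.Thm37Hypotheses)
    (hcyc : ∀ e : 𝒢.graph.Edge, ∃ t₀ : 𝒢.Ge e, (Subgroup.zpowers t₀).topologicalClosure = ⊤)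
    (c : TemperedPiChart 𝒢) (K : Subgroup c.G) (hKc : IsCompact (K : Set c.G)) (hK : K ≠ ⊥)
    (hfree : ∀ (v : 𝒢.graph.Vertex) (H : Subgroup c.G), H ∈ verticialSubgroups c v → K ⊓ H = ⊥) :
    ¬ MaximalCompactIffVerticialAt 𝒢 := by
  rw [𝒢.maximalCompactIffVerticialAt_iff_forall_maximalCompact_not_anchorFree_of_topCyclic hcyc]
  intro h
  obtain ⟨M, hM, hKM, hMfree⟩ :=
    exists_isMaximalCompactSubgroup_ge_forall_inf_verticial_eq_bot_of_topCyclic h37 hcyc c K hKc hK hfree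
  have hMne : M ≠ ⊥ := fun h0 => hK (le_bot_iff.mp (h0 ▸ hKM))
  obtain ⟨v, H, hH, hanch⟩ := h h37 c M hM hMne
  exact hanch (hMfree v H hH)

/-! ### Exotic compact subgroups are procyclic -/

namespace GaloisLevelData

variable (D : GaloisLevelData 𝒢) (h𝒢 : 𝒢.IsCountable)

/-- **A compact subgroup of `π₁^temp(𝒢) = lim_n Gal(𝒢_{∞,n}/𝒢)` whose level images lie in cyclic subgroups is
TOPOLOGICALLY CYCLIC**: if for every `n` all of `ρ_n(K)` lies in one cyclic subgroup `⟨γ_n⟩` of the discrete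
`Gal(𝒢_{∞,n}/𝒢)`, then `K = ⟨k⟩‾` for one `k ∈ K`.  (The finite cyclic `ρ_n(K)` has a generator coming from `K`;
the sets `A_n ⊆ K` of such elements are non-empty, closed, and DECREASE in `n` — a generator of `ρ_{n+1}(K)` maps
under the transition map to a generator of `ρ_n(K)` — so by compactness some `k` lies in all of them; then every
`g ∈ K` has all its level components in `⟨k⟩`, i.e. `g ∈ ⟨k⟩‾` (`mem_topologicalClosure_of_forall_proj`), and
`⟨k⟩‾ ≤ K` as `K` is closed.) [cite: MochizukiSemiAnbd2006, Prop 3.6(i) p.38] -/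
theorem exists_topologicalClosure_zpowers_eq_of_forall_le_zpowers (K : Subgroup (D.temperedPi h𝒢))
    (hKc : IsCompact (K : Set (D.temperedPi h𝒢)))
    (hcyc : ∀ n, ∃ γ : D.Gal h𝒢 n, ∀ g ∈ K, D.proj h𝒢 n g ∈ Subgroup.zpowers γ) :
    ∃ k ∈ K, (Subgroup.zpowers k).topologicalClosure = K := by
  classical
  -- `π₁^temp(𝒢)` is Hausdorff (open normal subgroups separate points)
  haveI : T2Space (D.temperedPi h𝒢) := by
    refine IsTopologicalGroup.t2Space_of_one_sep fun x hx => ?_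
    obtain ⟨M, hM⟩ := (D.isTempered_temperedPi h𝒢).separated x hx
    exact ⟨M, M.toOpenSubgroup.mem_nhds_one, hM⟩
  -- `A n`: the elements of `K` whose level-`n` component generates `ρ_n(K)`
  let A : ℕ → Set (D.temperedPi h𝒢) := fun n =>
    (K : Set (D.temperedPi h𝒢)) ∩
      D.proj h𝒢 n ⁻¹' {y | ∀ x ∈ K, D.proj h𝒢 n x ∈ Subgroup.zpowers y}
  have hAcl : ∀ n, IsClosed (A n) := fun n =>
    hKc.isClosed.inter ((isClosed_discrete _).preimage (D.continuous_proj h𝒢 n))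
  have hAne : ∀ n, (A n).Nonempty := by
    intro n
    obtain ⟨γ, hγ⟩ := hcyc n
    have hle : K.map (D.proj h𝒢 n) ≤ Subgroup.zpowers γ := by
      rintro y ⟨x, hx, rfl⟩
      exact hγ x hx
    haveI : IsCyclic (K.map (D.proj h𝒢 n)) :=
      isCyclic_of_injective (Subgroup.inclusion hle) (Subgroup.inclusion_injective hle)
    obtain ⟨⟨y, hy⟩, hgen⟩ := IsCyclic.exists_generator (α := K.map (D.proj h𝒢 n))
    obtain ⟨g, hg, hgy⟩ := Subgroup.mem_map.mp hy
    refine ⟨g, hg, fun x hx => ?_⟩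
    rw [hgy]
    obtain ⟨m, hm⟩ :=
      Subgroup.mem_zpowers_iff.mp (hgen ⟨D.proj h𝒢 n x, Subgroup.mem_map.mpr ⟨x, hx, rfl⟩⟩)
    exact Subgroup.mem_zpowers_iff.mpr ⟨m, by simpa using congrArg Subtype.val hm⟩
  have hAmono : ∀ n, A (n + 1) ⊆ A n := by
    rintro n g ⟨hg, hgen⟩
    refine ⟨hg, fun x hx => ?_⟩
    rw [← D.mapLE_proj h𝒢 (Nat.le_succ n) x, ← D.mapLE_proj h𝒢 (Nat.le_succ n) g]
    obtain ⟨m, hm⟩ := Subgroup.mem_zpowers_iff.mp (hgen x hx)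
    exact Subgroup.mem_zpowers_iff.mpr ⟨m, by rw [← map_zpow, hm]⟩
  obtain ⟨k, hk⟩ := IsCompact.nonempty_iInter_of_sequence_nonempty_isCompact_isClosed A hAmono hAne
    (hKc.of_isClosed_subset (hAcl 0) Set.inter_subset_left) hAcl
  rw [Set.mem_iInter] at hk
  refine ⟨k, (hk 0).1, le_antisymm ?_ fun x hx => ?_⟩
  · -- `⟨k⟩‾ ≤ K`, `K` being closed
    exact Subgroup.topologicalClosure_minimal _ ((Subgroup.zpowers_le).mpr (hk 0).1) hKc.isClosed
  · -- `K ≤ ⟨k⟩‾`: every level component of `x ∈ K` is a power of that of `k`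
    refine D.mem_topologicalClosure_of_forall_proj h𝒢 _ x fun n => ?_
    obtain ⟨m, hm⟩ := Subgroup.mem_zpowers_iff.mp ((hk n).2 x hx)
    exact ⟨k ^ m, Subgroup.zpow_mem_zpowers k m, by rw [map_zpow, hm]⟩

end GaloisLevelData

variable (𝒢)

/-- **With TOPOLOGICALLY CYCLIC edge groups, every compact subgroup of `π₁^temp(𝒢)` lying in NO verticial subgroup
is PROCYCLIC** (canonical chart; any countable `𝒢` as in Prop. 3.6, any `𝔾`): `K = ⟨k⟩‾` for one `k ∈ K` — such `K`
is levelwise cyclic (abc-iut-w6-d064's `forall_level_exists_zpowers_of_forall_not_le_verticial_of_topCyclic`) and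
`GaloisLevelData.exists_topologicalClosure_zpowers_eq_of_forall_le_zpowers` applies.  So every violator of the
existence sentence of Thm 3.7 (iii) and every exotic maximal compact subgroup on the class is a procyclic group,
like `⟨c⟩‾ ≅ ℤ_p` at `𝒢⋆(p)` and the exotic maximal compact `ℤ_p` at `𝒢_θ`.
[cite: MochizukiSemiAnbd2006, Thm 3.7(iii) pp.40-41] -/
theorem exists_topologicalClosure_zpowers_eq_of_forall_not_le_verticial_of_topCyclic (h36 : 𝒢.Prop36Hypotheses)
    (hcyc : ∀ e : 𝒢.graph.Edge, ∃ t₀ : 𝒢.Ge e, (Subgroup.zpowers t₀).topologicalClosure = ⊤)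
    (K : Subgroup (𝒢.temperedPiChart h36).G) (hKc : IsCompact (K : Set (𝒢.temperedPiChart h36).G))
    (hno : ∀ (v : 𝒢.graph.Vertex) (H : Subgroup (𝒢.temperedPiChart h36).G),
      H ∈ verticialSubgroups (𝒢.temperedPiChart h36) v → ¬ K ≤ H) :
    ∃ k ∈ K, (Subgroup.zpowers k).topologicalClosure = K :=
  (𝒢.galoisLevelData h36).exists_topologicalClosure_zpowers_eq_of_forall_le_zpowers h36.isCountable K hKc
    (𝒢.forall_level_exists_zpowers_of_forall_not_le_verticial_of_topCyclic h36 hcyc K hKc hno)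

variable {𝒢}

/-- **The same at EVERY chart** (transport along `TemperedPiChart.exists_compatIso`: the image in the canonical chart
of a compact subgroup in no verticial subgroup is such a subgroup there, verticial subgroups corresponding under the
compatible isomorphism, and topological closures of cyclic subgroups correspond under a homeomorphic isomorphism).
[cite: MochizukiSemiAnbd2006, Thm 3.7(iii) pp.40-41] -/
theorem TemperedPiChart.exists_topologicalClosure_zpowers_eq_of_forall_not_le_verticial_of_topCyclic
    (h36 : 𝒢.Prop36Hypotheses)
    (hcyc : ∀ e : 𝒢.graph.Edge, ∃ t₀ : 𝒢.Ge e, (Subgroup.zpowers t₀).topologicalClosure = ⊤)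
    (c : TemperedPiChart 𝒢) (K : Subgroup c.G) (hKc : IsCompact (K : Set c.G))
    (hno : ∀ (v : 𝒢.graph.Vertex) (H : Subgroup c.G), H ∈ verticialSubgroups c v → ¬ K ≤ H) :
    ∃ k ∈ K, (Subgroup.zpowers k).topologicalClosure = K := by
  obtain ⟨φ, ψ, hψφ, hφψ, hφ, -⟩ := TemperedPiChart.exists_compatIso (𝒢.temperedPiChart h36) c
  have hK' : IsCompact ((K.map ψ.toMonoidHom : Subgroup (𝒢.temperedPiChart h36).G) :
      Set (𝒢.temperedPiChart h36).G) := by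
    rw [Subgroup.coe_map]
    exact hKc.image ψ.continuous
  have hno' : ∀ (v : 𝒢.graph.Vertex) (H : Subgroup (𝒢.temperedPiChart h36).G),
      H ∈ verticialSubgroups (𝒢.temperedPiChart h36) v → ¬ K.map ψ.toMonoidHom ≤ H := by
    intro v H hH hle
    exact hno v (H.map φ.toMonoidHom) (mem_verticialSubgroups_map φ hφ hH)
      fun g hg => ⟨ψ g, hle ⟨g, hg, rfl⟩, hφψ g⟩
  obtain ⟨k', hk'K, hk'⟩ := 𝒢.exists_topologicalClosure_zpowers_eq_of_forall_not_le_verticial_of_topCyclic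
    h36 hcyc (K.map ψ.toMonoidHom) hK' hno'
  obtain ⟨k, hk, rfl⟩ := Subgroup.mem_map.mp hk'K
  refine ⟨k, hk, ?_⟩
  -- `ψ` is a homeomorphism, so it commutes with topological closures; and `Subgroup.map ψ` is injective
  let e : c.G ≃ₜ (𝒢.temperedPiChart h36).G :=
    { toFun := ψ, invFun := φ, left_inv := hφψ, right_inv := hψφ,
      continuous_toFun := ψ.continuous, continuous_invFun := φ.continuous }
  have hinj : Function.Injective ψ.toMonoidHom := fun a b h => by
    rw [← hφψ a, ← hφψ b]
    exact congrArg φ h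
  refine Subgroup.map_injective hinj (SetLike.coe_injective ?_)
  rw [← hk', Subgroup.coe_map, Subgroup.topologicalClosure_coe, Subgroup.topologicalClosure_coe,
    ← MonoidHom.map_zpowers, Subgroup.coe_map]
  exact e.image_closure _

/-- **In particular every EXOTIC MAXIMAL compact subgroup (one that is not verticial) is procyclic**, for `𝒢` as in
Prop. 3.6 with topologically cyclic edge groups, at every chart: a maximal compact subgroup contained in a verticial
subgroup equals it, so a non-verticial one lies in none. [cite: MochizukiSemiAnbd2006, Thm 3.7(iv) p.41] -/
theorem exists_topologicalClosure_zpowers_eq_of_isMaximalCompactSubgroup_of_not_verticial_of_topCyclic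
    (h36 : 𝒢.Prop36Hypotheses)
    (hcyc : ∀ e : 𝒢.graph.Edge, ∃ t₀ : 𝒢.Ge e, (Subgroup.zpowers t₀).topologicalClosure = ⊤)
    (c : TemperedPiChart 𝒢) (K : Subgroup c.G) (hK : IsMaximalCompactSubgroup K)
    (hKv : ∀ v : 𝒢.graph.Vertex, K ∉ verticialSubgroups c v) :
    ∃ k ∈ K, (Subgroup.zpowers k).topologicalClosure = K := by
  refine TemperedPiChart.exists_topologicalClosure_zpowers_eq_of_forall_not_le_verticial_of_topCyclic h36 hcyc
    c K hK.1 fun v H hH hKH => hKv v ?_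
  exact hK.2 H (isCompact_of_mem_verticialSubgroups _ hH) hKH ▸ hH

/-- **A non-trivial anchor-free compact subgroup is procyclic and lies below a procyclic anchor-free maximal compact
subgroup** (Thm 3.7 hypotheses, topologically cyclic edge groups, any `𝔾`, every chart) — the joint shape of the
two failure loci of `TemperedThm37iiiIffNoAnchorFree.lean`. [cite: MochizukiSemiAnbd2006, Thm 3.7(iv) p.41] -/
theorem exists_procyclic_maximalCompact_ge_of_anchorFree_of_topCyclic (h37 : 𝒢.Thm37Hypotheses)
    (hcyc : ∀ e : 𝒢.graph.Edge, ∃ t₀ : 𝒢.Ge e, (Subgroup.zpowers t₀).topologicalClosure = ⊤)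
    (c : TemperedPiChart 𝒢) (K : Subgroup c.G) (hKc : IsCompact (K : Set c.G)) (hK : K ≠ ⊥)
    (hfree : ∀ (v : 𝒢.graph.Vertex) (H : Subgroup c.G), H ∈ verticialSubgroups c v → K ⊓ H = ⊥) :
    ∃ (M : Subgroup c.G) (m : c.G), m ∈ M ∧ IsMaximalCompactSubgroup M ∧ K ≤ M ∧
      (Subgroup.zpowers m).topologicalClosure = M ∧
      ∀ (v : 𝒢.graph.Vertex) (H : Subgroup c.G), H ∈ verticialSubgroups c v → M ⊓ H = ⊥ := by
  obtain ⟨M, hM, hKM, hMfree⟩ :=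
    exists_isMaximalCompactSubgroup_ge_forall_inf_verticial_eq_bot_of_topCyclic h37 hcyc c K hKc hK hfree
  have hMne : M ≠ ⊥ := fun h0 => hK (le_bot_iff.mp (h0 ▸ hKM))
  have hMno : ∀ (v : 𝒢.graph.Vertex) (H : Subgroup c.G), H ∈ verticialSubgroups c v → ¬ M ≤ H := by
    intro v H hH hMH
    have h := hMfree v H hH
    rw [inf_eq_left.mpr hMH] at h
    exact hMne h
  obtain ⟨m, hm, hmM⟩ :=
    TemperedPiChart.exists_topologicalClosure_zpowers_eq_of_forall_not_le_verticial_of_topCyclic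
      h37.toProp36Hypotheses hcyc c M hM.1 hMno
  exact ⟨M, m, hm, hM, hKM, hmM, hMfree⟩

/-! ### Instances: the rayless star `𝒢⋆(p)` and the ray `𝒢_θ(p, n)` -/

section Instances

variable (p : ℕ) [hp : Fact p.Prime] (n : ℕ → ℕ)

/-- **At `𝒢⋆(p)`: every compact subgroup of `π₁^temp(𝒢⋆(p))` (canonical chart) lying in no verticial subgroup —
e.g. abc-iut-L3-t8's escaping `⟨c⟩‾` — is PROCYCLIC**, hypothesis-free. [cite: MochizukiSemiAnbd2006, Thm 3.7(iv) p.41] -/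
theorem metabelianLeafStar_exists_topologicalClosure_zpowers_eq_of_forall_not_le_verticial
    (K : Subgroup ((metabelianLeafStar p).temperedPiChart
      (metabelianLeafStar_thm37Hypotheses' p).toProp36Hypotheses).G)
    (hKc : IsCompact (K : Set ((metabelianLeafStar p).temperedPiChart
      (metabelianLeafStar_thm37Hypotheses' p).toProp36Hypotheses).G))
    (hno : ∀ (v : (metabelianLeafStar p).graph.Vertex) (H : Subgroup ((metabelianLeafStar p).temperedPiChart
      (metabelianLeafStar_thm37Hypotheses' p).toProp36Hypotheses).G),
      H ∈ verticialSubgroups _ v → ¬ K ≤ H) :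
    ∃ k ∈ K, (Subgroup.zpowers k).topologicalClosure = K :=
  (metabelianLeafStar p).exists_topologicalClosure_zpowers_eq_of_forall_not_le_verticial_of_topCyclic _
    (fun _ => multiplicative_padicInt_topCyclic p) K hKc hno

/-- **At `𝒢_θ(p, n)`: every compact subgroup of `π₁^temp(𝒢_θ)` (canonical chart) lying in no verticial subgroup —
e.g. abc-iut-w6-d063's exotic maximal compact subgroup — is PROCYCLIC**, hypothesis-free.
[cite: MochizukiSemiAnbd2006, Thm 3.7(iv) p.41] -/
theorem thetaRayFreeProP_exists_topologicalClosure_zpowers_eq_of_forall_not_le_verticial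
    (K : Subgroup ((thetaRayFreeProP p n).temperedPiChart
      (thetaRayFreeProP_thm37Hypotheses' p n).toProp36Hypotheses).G)
    (hKc : IsCompact (K : Set ((thetaRayFreeProP p n).temperedPiChart
      (thetaRayFreeProP_thm37Hypotheses' p n).toProp36Hypotheses).G))
    (hno : ∀ (v : (thetaRayFreeProP p n).graph.Vertex) (H : Subgroup ((thetaRayFreeProP p n).temperedPiChart
      (thetaRayFreeProP_thm37Hypotheses' p n).toProp36Hypotheses).G),
      H ∈ verticialSubgroups _ v → ¬ K ≤ H) :
    ∃ k ∈ K, (Subgroup.zpowers k).topologicalClosure = K :=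
  (thetaRayFreeProP p n).exists_topologicalClosure_zpowers_eq_of_forall_not_le_verticial_of_topCyclic _
    (fun _ => multiplicative_padicInt_topCyclic p) K hKc hno

end Instances

end ProfiniteSemiGraph

end Literature.AnabelianGeometry.SemiGraphs
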